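import Literature.NumberTheory.Rogawski1990.OneDimAutRepH                          -- ★ D5 `OneDimAutRepH`: `bcη/ψ`, `eη/ψ`, `expAt_embedding`
import Literature.NumberTheory.Rogawski1990.XiArchPinned                           -- `XiArchPinned`, `isCohTrivialAt_tOfArchType_iff` (F0-typ1 (g5))
import Literature.NumberTheory.GaloisRepresentations.HeckeCharacterArchType          -- ★ `HeckeCharacter.HasUnitaryArchType`, `archUnitaryValue`
import Literature.NumberTheory.Automorphic.ConjugateSelfDualCharacters               -- ★ `IdeleClassGroup.weight`
import Literature.NumberTheory.Automorphic.UnitaryGroupAdelicCharactersArchTypeTwist -- ★ `HasUnitaryArchType.mul_zero_right`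
import HarnessLib

/-!
# FLOOR-0 P2 — PKΠ RUNG 4, ROW «RIG∞-ARITH»: the archimedean rigidity letter RIG∞″ as character arithmetic (in-house, M; theorems only)

Cell hodgecm-mathlib (D-0151), FLOOR 0, programme P2 (theta ∕ `hdictE`); crux item H413 = stmt-HodgeConjecture-24833 (`HCCMUnconditional.H413`);
sub-line `Cruxes/H413/Lines/F0_P2PKPiRung4.lean` (F0P2-plan (g6), «PKΠ ⟸ S2 + GRD + RIG∞ + RIGf (+ ★LTY by name)»).  Row «RIG∞-ARITH» dealt
2026-08-31T09:16:32Z ∕ 09:17:08Z to seat B-p18 (g26); SPEC `F0/P2/RIGinfArith.spec.F0P2-plan-g6.lean` sha16 852a09fa05a07046 (the v1.2 ENGINE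
letter `StubRIGinfArith` and the five row signatures `RowA1 … RowA4`, `RowB1`, restated below TOKEN FOR TOKEN as theorems).  THEOREMS ONLY (no `def`,
no instance, no notation, no named fact, no `sorry`); never imports a `Cruxes/…/Lines` module (the head RESTATES the body of the sub-line's
`StubRIGinfArith`, so the Lines edition folds it by `exact`); `--supports stmt-HodgeConjecture-24833 --as helper`.  HC_CM is proved only modulo
the printed citations until rung 0 closes; this file discharges none of them.

WHAT RIG∞″ SAYS.  `ξ = (η ∘ det₀)·(ψ ∘ det)` is a one-dimensional automorphic representation of `H = U(2) × U(1)` over the CM field `L`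
(★ `OneDimAutRepH`), with base changes `η̃ = ξ.bcη`, `ψ̃ = ξ.bcψ` of unitary archimedean types `(2eη, 0)`, `(2eψ, 0)`; `μω` is a Hecke character
of unitary archimedean type `(k, 0)`.  Under the ARCHIMEDEAN PIN `XiArchPinned L ξ μω k` (`k` odd and `ξ_ι` of cohomological type for trivial
coefficients w.r.t. Rogawski's parameter `t = (−expAt k ι − 1)/2` of `μω` at every embedding `ι`, [Rogawski1990, Prop. 15.2.1 (b)]):
* the product `η̃⁻¹ψ̃⁻¹μω` has unitary type `k − 2eη − 2eψ`, of WEIGHT ONE at every place (`= ∓1` according as `eψ = ∓1`);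
* `ν := ψ̃⁻¹(η̃⁻¹ψ̃⁻¹μω)²` has unitary type `(0, 0)`;
and (row B1, used by the (G-χ) glue) a Hecke character of type `(0,0)` kills the principal FINITE idèles `(1_∞, b_f)`, `b ∈ Lˣ`.
Everything is `zpow` ∕ `Finset.prod` algebra over ★ `HasUnitaryArchType.mul_zero_right`, ★ `expAt_embedding` and `omega`.

## Contents
* §0 (plumbing) `hasUnitaryArchType_congr_left` (pointwise-equal exponents; public, for the G-μ glue), private `archUnitaryValue_zero_zero`.
* §1 **`hasUnitaryArchType_inv_zero_right`** (= spec `RowA1`: inverses negate types `(e,0)`) · **`hasUnitaryArchType_grdProduct`** (= `RowA2`: type of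
  `η̃⁻¹ψ̃⁻¹μω` is `k − 2eη − 2eψ`).
* §2 **`grdExponent_cases_of_xiArchPinned`** (= `RowA3`: under the pin, per place, `(eψ, k − 2eη − 2eψ) ∈ {(−1,−1), (1,1)}`) ·
  **`hasUnitaryArchType_zero_grdNu_of_xiArchPinned`** (= `RowA4`: `ν` has type `(0,0)`).
* §3 `principalIdele_eq_infiniteIdeles_mul_inr` (`(b) = (b_∞,1)·(1_∞,b_f)`: ★ `principalIdele` = ★ `infiniteIdeles ∘ globalToInfiniteUnits` times
  the finite part, by `Units.ext` ∕ `rfl`) · **`apply_inr_principal_eq_one_of_hasUnitaryArchType_zero`** (= `RowB1`: type `(0,0)` kills `(1_∞, b_f)`).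
* §4 **`stubRIGinfArith_holds`** — the body of the sub-line's `StubRIGinfArith` VERBATIM (weight one by A3 + ★ `weight_apply`; A2; A4).

## References
* [Rogawski1990] J. Rogawski, *Automorphic Representations of Unitary Groups in Three Variables*, Ann. of Math. Stud. 123 (1990): §12.3 pp. 174–178
  (`μ(z) = (z/z̄)^{t+1/2}`, `ξ(h) = det₀(h)^{−m−t−1} det(h)^a`), Prop. 15.2.1 (b) (cohomological `ξ_∞`).
* [Patrikis2019] S. Patrikis, *Variations on a theorem of Tate*, Mem. AMS 258 (2019): §2.1 (unitary archimedean parameters `(m_v, t_v)`).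
* [WeilBNT1967] A. Weil, *Basic Number Theory* (1967): Ch. VII §3 (characters of the idèle class group; principal idèles).
-/

set_option autoImplicit false
-- the mandated namespace has the single-problem summit's repeated segment (`HodgeConjecture.HodgeConjecture`)
set_option linter.dupNamespace false

noncomputable section

open NumberField IsDedekindDomain

namespace Summit.HodgeConjecture.HodgeConjecture.Cruxes.H413.F0P2iRIGinfArith

open Literature.NumberTheory.Rogawski1990 Literature.NumberTheory.GaloisRepresentations
open Literature.NumberTheory.GaloisRepresentations.HeckeCharacter.CMQuadraticExtension (archUnitaryValue_zero_right)
open Literature.NumberTheory.Automorphic Literature.NumberTheory.Automorphic.IdeleClassGroup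

/-! ## §0 `HasUnitaryArchType` plumbing -/

/-- **Pointwise-equal exponent families define the same unitary archimedean type** (the type is a function `InfinitePlace L → ℤ`;
consumers produce it by arithmetic and need to re-bracket it). [cite: Patrikis2019, §2.1] -/
theorem hasUnitaryArchType_congr_left {L : Type} [Field L] [NumberField L] {χ : HeckeCharacter L}
    {m m' : InfinitePlace L → ℤ} {t : InfinitePlace L → ℝ} (hmm' : ∀ w, m w = m' w) (h : χ.HasUnitaryArchType m t) :
    χ.HasUnitaryArchType m' t := by
  obtain rfl : m = m' := funext hmm'
  exact h

/-- The unitary archimedean value with parameters `(0, 0)` is `1`. [folklore] -/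
private theorem archUnitaryValue_zero_zero (z : ℂ) : archUnitaryValue 0 0 z = 1 := by
  rw [archUnitaryValue_zero_right, zpow_zero]

/-! ## §1 ROW RIG∞-A1 ∕ A2: inverses negate, products add -/

/-- **ROW RIG∞-A1** — inverses negate unitary archimedean types `(e, 0)`: if `χ_∞(x) = ∏_w (ι_w x_w/|ι_w x_w|)^{e_w}`
then `χ⁻¹_∞(x) = ∏_w (ι_w x_w/|ι_w x_w|)^{−e_w}`.  (Spec `RowA1` token for token.) [cite: Patrikis2019, §2.1] -/
theorem hasUnitaryArchType_inv_zero_right :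
    ∀ (L : Type) [Field L] [NumberField L] (χ : HeckeCharacter L) (e : InfinitePlace L → ℤ),
      χ.HasUnitaryArchType e (fun _ => 0) → χ⁻¹.HasUnitaryArchType (fun w => - e w) (fun _ => 0) := by
  intro L _ _ χ e hχ x
  rw [HeckeCharacter.inv_apply, Units.val_inv_eq_inv_val, hχ x, ← Finset.prod_inv_distrib]
  refine Finset.prod_congr rfl fun w _ => ?_
  rw [archUnitaryValue_zero_right, archUnitaryValue_zero_right, zpow_neg]

/-- **ROW RIG∞-A2** — the unitary archimedean type of the product `η̃⁻¹ · ψ̃⁻¹ · μω`: from `μω` of type `(k, 0)` and the base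
changes `η̃`, `ψ̃` of types `(2eη, 0)`, `(2eψ, 0)` (★ `hasUnitaryArchType_bcη` ∕ `_bcψ`), the product has type `(k − 2eη − 2eψ, 0)`.
(Spec `RowA2` token for token.) [cite: Rogawski1990, §12.3 pp. 174–178] -/
theorem hasUnitaryArchType_grdProduct :
    ∀ (L : Type) [Field L] [NumberField L] [IsCMField L] (ξ : OneDimAutRepH L) (μω : HeckeCharacter L)
      (k : InfinitePlace L → ℤ), μω.HasUnitaryArchType k (fun _ => 0) →
        (ξ.bcη⁻¹ * ξ.bcψ⁻¹ * μω).HasUnitaryArchType (fun w => k w - 2 * ξ.eη w - 2 * ξ.eψ w) (fun _ => 0) := by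
  intro L _ _ _ ξ μω k hk
  have hη : ξ.bcη⁻¹.HasUnitaryArchType (fun w => -(2 * ξ.eη w)) (fun _ => 0) :=
    hasUnitaryArchType_inv_zero_right L ξ.bcη _ ξ.hasUnitaryArchType_bcη
  have hψ : ξ.bcψ⁻¹.HasUnitaryArchType (fun w => -(2 * ξ.eψ w)) (fun _ => 0) :=
    hasUnitaryArchType_inv_zero_right L ξ.bcψ _ ξ.hasUnitaryArchType_bcψ
  have h : (ξ.bcη⁻¹ * ξ.bcψ⁻¹ * μω).HasUnitaryArchType (fun w => -(2 * ξ.eη w) + -(2 * ξ.eψ w) + k w) (fun _ => 0) :=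
    (hη.mul_zero_right L hψ).mul_zero_right L hk
  exact hasUnitaryArchType_congr_left (fun w => by ring) h

/-! ## §2 ROW RIG∞-A3 ∕ A4: the archimedean pin in exponents -/

/-- **ROW RIG∞-A3** — under the archimedean pin `XiArchPinned L ξ μω k`, at every place `w` (read through Mathlib's embedding
`ι_w = w.embedding`, where `expAt e ι_w = −e_w`, ★ `expAt_embedding`): either `eψ_w = −1` and `k_w − 2eη_w − 2eψ_w = −1`, or `eψ_w = 1` and
`k_w − 2eη_w − 2eψ_w = 1` — the two cohomological cases `(q, 2p − x) ∈ {(1, −3), (−1, 3)}` of `isCohTrivialAt_tOfArchType_iff`.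
(Spec `RowA3` token for token.) [cite: Rogawski1990, Prop. 15.2.1 (b); §12.3 p. 178] -/
theorem grdExponent_cases_of_xiArchPinned :
    ∀ (L : Type) [Field L] [NumberField L] [IsCMField L] (ξ : OneDimAutRepH L) (μω : HeckeCharacter L)
      (k : InfinitePlace L → ℤ), XiArchPinned L ξ μω k → ∀ w : InfinitePlace L,
        (ξ.eψ w = -1 ∧ k w - 2 * ξ.eη w - 2 * ξ.eψ w = -1) ∨ (ξ.eψ w = 1 ∧ k w - 2 * ξ.eη w - 2 * ξ.eψ w = 1) := by
  intro L _ _ _ ξ μω k hpin w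
  have h := (isCohTrivialAt_tOfArchType_iff ξ k hpin.2.1 w.embedding).1 (hpin.2.2 w.embedding)
  simp only [OneDimAutRepH.qψ, OneDimAutRepH.pη, OneDimAutRepH.expAt_embedding] at h
  omega

/-- **ROW RIG∞-A4** — under the pin, `ν := ψ̃⁻¹ · (η̃⁻¹ψ̃⁻¹μω)²` has unitary archimedean type `(0, 0)`: its exponent at `w` is
`−2eψ_w + 2(k_w − 2eη_w − 2eψ_w)`, which vanishes in both cases of A3. (Spec `RowA4` token for token.)
[cite: Rogawski1990, Prop. 15.2.1 (b); §12.3 p. 178] -/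
theorem hasUnitaryArchType_zero_grdNu_of_xiArchPinned :
    ∀ (L : Type) [Field L] [NumberField L] [IsCMField L] (ξ : OneDimAutRepH L) (μω : HeckeCharacter L)
      (k : InfinitePlace L → ℤ), XiArchPinned L ξ μω k →
        (ξ.bcψ⁻¹ * (ξ.bcη⁻¹ * ξ.bcψ⁻¹ * μω) ^ 2).HasUnitaryArchType (fun _ => 0) (fun _ => 0) := by
  intro L _ _ _ ξ μω k hpin
  have hP := hasUnitaryArchType_grdProduct L ξ μω k hpin.1
  have hψ : ξ.bcψ⁻¹.HasUnitaryArchType (fun w => -(2 * ξ.eψ w)) (fun _ => 0) :=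
    hasUnitaryArchType_inv_zero_right L ξ.bcψ _ ξ.hasUnitaryArchType_bcψ
  have h : (ξ.bcψ⁻¹ * ((ξ.bcη⁻¹ * ξ.bcψ⁻¹ * μω) * (ξ.bcη⁻¹ * ξ.bcψ⁻¹ * μω))).HasUnitaryArchType
      (fun w => -(2 * ξ.eψ w) + ((k w - 2 * ξ.eη w - 2 * ξ.eψ w) + (k w - 2 * ξ.eη w - 2 * ξ.eψ w))) (fun _ => 0) :=
    hψ.mul_zero_right L (hP.mul_zero_right L hP)
  rw [pow_two]
  refine hasUnitaryArchType_congr_left (fun w => ?_) h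
  rcases grdExponent_cases_of_xiArchPinned L ξ μω k hpin w with ⟨h1, h2⟩ | ⟨h1, h2⟩ <;> omega

/-! ## §3 ROW RIG∞-B1: a type-`(0,0)` character kills the principal finite idèles -/

/-- **The principal idèle splits into its infinite and finite parts**: `(b) = (b_∞, 1) · (1_∞, b_f)` in `𝕀_L = (L ⊗ ℝ)ˣ × 𝔸_{L,f}ˣ`
(★ `principalIdele`, ★ `infiniteIdeles`, ★ `globalToInfiniteUnits`; the finite part is `Units.map inr (b_f)`). [cite: WeilBNT1967, Ch. IV §3] -/
theorem principalIdele_eq_infiniteIdeles_mul_inr {L : Type} [Field L] [NumberField L] (b : Lˣ) :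
    Literature.NumberTheory.GaloisRepresentations.principalIdele L b = infiniteIdeles L (globalToInfiniteUnits L b) *
      Units.map (N := AdeleRing (𝓞 L) L) (MonoidHom.inr (InfiniteAdeleRing L) (FiniteAdeleRing (𝓞 L) L))
        (Units.map (algebraMap L (FiniteAdeleRing (𝓞 L) L)).toMonoidHom b) := by
  apply Units.ext
  change algebraMap L (AdeleRing (𝓞 L) L) (b : L) =
    ((algebraMap L (InfiniteAdeleRing L) (b : L), (1 : FiniteAdeleRing (𝓞 L) L)) : AdeleRing (𝓞 L) L) *
      (((1 : InfiniteAdeleRing L), algebraMap L (FiniteAdeleRing (𝓞 L) L) (b : L)) : AdeleRing (𝓞 L) L)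
  rw [Prod.mk_mul_mk, mul_one, one_mul]
  rfl

/-- **ROW RIG∞-B1** — a Hecke character `ν` of unitary archimedean type `(0, 0)` is trivial on the principal FINITE idèles
`(1_∞, b_f)`, `b ∈ Lˣ`: the principal idèle `(b)` splits as `(b_∞, 1) · (1_∞, b_f)`, `ν((b)) = 1` (★ `map_principal`) and
`ν((b_∞, 1)) = ∏_w archUnitaryValue 0 0 (ι_w b) = 1`. (Spec `RowB1` token for token.) [cite: WeilBNT1967, Ch. VII §3] -/
theorem apply_inr_principal_eq_one_of_hasUnitaryArchType_zero :
    ∀ (L : Type) [Field L] [NumberField L] (ν : HeckeCharacter L),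
      ν.HasUnitaryArchType (fun _ => 0) (fun _ => 0) → ∀ b : Lˣ,
        ν (Units.map (N := AdeleRing (𝓞 L) L) (MonoidHom.inr (InfiniteAdeleRing L) (FiniteAdeleRing (𝓞 L) L))
          (Units.map (algebraMap L (FiniteAdeleRing (𝓞 L) L)).toMonoidHom b)) = 1 := by
  intro L _ _ ν hν b
  -- `ν` is `1` on the infinite part (type `(0,0)`) and on the whole principal idèle, which splits
  have hinf : ν (infiniteIdeles L (globalToInfiniteUnits L b)) = 1 := by
    rw [← Units.val_eq_one, hν]
    exact Finset.prod_eq_one fun w _ => archUnitaryValue_zero_zero _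
  have hprin : ν (Literature.NumberTheory.GaloisRepresentations.principalIdele L b) = 1 :=
    ν.map_principal (Literature.NumberTheory.GaloisRepresentations.principalIdele_mem b)
  rwa [principalIdele_eq_infiniteIdeles_mul_inr, map_mul, hinf, one_mul] at hprin

/-! ## §4 The head: `StubRIGinfArith` of the sub-line `Cruxes/H413/Lines/F0_P2PKPiRung4.lean` (v1.2 ENGINE letter RIG∞″) -/

/-- **RIG∞″ — archimedean rigidity as character arithmetic** (the body of the sub-line's `StubRIGinfArith`, VERBATIM): under the
archimedean pin of `ξ` relative to `μω` (type `k`), the product `η̃⁻¹ψ̃⁻¹μω` has unitary type `k − 2eη − 2eψ` of WEIGHT ONE at every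
place (A2 + A3), and `ν := ψ̃⁻¹(η̃⁻¹ψ̃⁻¹μω)²` has unitary type `(0, 0)` (A4). [cite: Rogawski1990, Prop. 15.2.1 (b); §12.3 pp. 174–178] -/
theorem stubRIGinfArith_holds :
    ∀ (L : Type) [Field L] [NumberField L] [IsCMField L] (ξ : OneDimAutRepH L) (μω : HeckeCharacter L)
    (k : InfinitePlace L → ℤ), XiArchPinned L ξ μω k →
      (∀ w : InfinitePlace L, weight (fun w => k w - 2 * ξ.eη w - 2 * ξ.eψ w) w = 1) ∧
      (ξ.bcη⁻¹ * ξ.bcψ⁻¹ * μω).HasUnitaryArchType (fun w => k w - 2 * ξ.eη w - 2 * ξ.eψ w) (fun _ => 0) ∧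
      (ξ.bcψ⁻¹ * (ξ.bcη⁻¹ * ξ.bcψ⁻¹ * μω) ^ 2).HasUnitaryArchType (fun _ => 0) (fun _ => 0) := by
  intro L _ _ _ ξ μω k hpin
  refine ⟨fun w => ?_, hasUnitaryArchType_grdProduct L ξ μω k hpin.1,
    hasUnitaryArchType_zero_grdNu_of_xiArchPinned L ξ μω k hpin⟩
  rw [weight_apply]
  rcases grdExponent_cases_of_xiArchPinned L ξ μω k hpin w with ⟨_, h⟩ | ⟨_, h⟩ <;> rw [h] <;> rfl

end Summit.HodgeConjecture.HodgeConjecture.Cruxes.H413.F0P2iRIGinfArith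

end
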